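import Literature.AnabelianGeometry.SemiGraphs.PullbackFunctor

/-!
# Finite étale coverings of semi-graphs of anabelioids: the GLOBAL clause and BRANCH ALIGNMENT — DEFINITIONS

Mochizuki, *Semi-graphs of anabelioids*, Publ. RIMS **42** (2006) 221–322, §2, Definition 2.2 (i)
and the paragraph before it, author's manuscript p. 23 [cite: MochizukiSemiAnbd2006, Def. 2.2(i) p.23]:
"`B′` itself arises naturally as the `B(−)` of some semi-graph of anabelioids `𝒢′` equipped with a
morphism `𝒢′ → 𝒢` … `B′ = B(𝒢)_{G′}`" — the finite étale covering of `𝒢` attached to an object of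
`B(𝒢)` is a CONSTRUCTION.  abc-iut-L3-t1's `Hom.IsFiniteEtaleCoveringOf` (`Coverticial.lean`) types
its LOCAL description (vertices/edges = connected components of the `S_v`, `T_e`; constituents =
the component anabelioids); this Coverticial-INDEPENDENT definitions file (abc-iut rulings
ζ2/RQ11, κ2/RQ13, μ2/RQ14, L3-lead 2026-08-25) names the two further clauses of print's notion, so
that `Coverticial.lean` (rev 4) can import them and define the covering notion of record
`Hom.IsFiniteEtaleCoveringGlobal := ∃ A, local ∧ global ∧ branch-aligned`:

* `Hom.IsGlobalCoveringOf φ A` — the GLOBAL clause "`B(𝒢′) = B(𝒢)_{/A}` via `φ^*`" (body VERBATIM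
  that of `Hom.IsBObjCoveringOf` of `FiniteEtaleCoveringGlobal.lean`, under a new name per RULING π2 —
  the old name stays as an alias until the dictionary migrates; finder of its necessity:
  abc-iut-L6-d4, RQ11): there is an equivalence `α : B(𝒢)_{/A} ⥲ B(𝒢′)` with `φ^* ≅ (A × −) ⋙ α`;
* `Hom.φBOver`, `Hom.alignIso`, `Hom.alignedBranchSubgroup`, `Hom.IsBranchAligned` — BRANCH
  ALIGNMENT (text of abc-iut-L4-t17, finding L4t17-F1 / ruling μ2, folded verbatim): the 2-cells
  `φ_{b′}` (`Hom.φB`) are DATA, and neither the local nor the global clause pins the branch functors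
  `b′^*` of `𝒢′` beyond a `Π_v`-twist invisible to `B(𝒢′)`; branch alignment says (i) the branch group
  of the covering is `Π_b ∩ Π_{v′}` in the aligned frame and (ii) distinct branches over the same
  `b` give distinct `(Π_b^{al}, ι(Π_{v′}))`-double cosets — true for the construction `𝒢_A`, false
  for twisted branch functors; the dictionary facts (D5)–(D7) take it as a hypothesis.

G1 (junk/vacuity): for the identity covering (`A` terminal) all clauses hold with `α` the
equivalence `Over ⊤ ≌ B(𝒢)` and identity 2-cells; L6-d4's `S₃/A₃` double loop satisfies the local
clause but not `IsGlobalCoveringOf`, and L4-t17's twisted branch functors satisfy local ∧ global but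
not `IsBranchAligned` — so neither clause is redundant.  No facts (`Prop`-valued claims) are stated
here; nothing takes a side on [IUTchIII] Cor. 3.12.
-/

namespace Literature.AnabelianGeometry.SemiGraphs

open CategoryTheory CategoryTheory.Limits CategoryTheory.Functor
open Literature.AnabelianGeometry.Anabelioids

universe v₁ u₁ u

namespace SemiGraphOfAnabelioids

variable {𝒢 𝒢' : SemiGraphOfAnabelioids.{v₁, u₁, u}}

/-! ### The global clause `B(𝒢′) = B(𝒢)_{/A}` -/

/-- Print's "finite étale covering of `B(𝒢)_{/A}`" condition ([SemiAnbd] p. 23 / p. 30) for a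
morphism `φ : 𝒢′ → 𝒢` and an object `A ∈ B(𝒢)`: "`B′ = B(𝒢)_{G′}` … arises as the `B(−)` of `𝒢′`" —
there is an equivalence `α : B(𝒢)_{/A} ⥲ B(𝒢′)` with `φ^* ≅ (A × −) ⋙ α` (the binary products of
`B(𝒢)` used to state `Over.star` exist for every `𝒢`; the instance is carried as part of the datum).
Body identical to `Hom.IsBObjCoveringOf` (`FiniteEtaleCoveringGlobal.lean`), which stays as the
dictionary-v2-facing ALIAS until the migration of RULING π2 removes it — declared here, below
`Coverticial.lean`, because Coverticial rev 4 must import it (import cycle otherwise; RULINGS κ2/π2,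
tree-health RQ16). [cite: MochizukiSemiAnbd2006, Def. 2.2(i) p.23] -/
def Hom.IsGlobalCoveringOf (φ : Hom 𝒢' 𝒢) (A : 𝒢.BObj) : Prop :=
  ∃ (_ : HasBinaryProducts 𝒢.BObj) (α : Over A ⥤ 𝒢'.BObj),
    α.IsEquivalence ∧ Nonempty (φ.pullbackFunctor ≅ Over.star A ⋙ α)

/-! ### Branch alignment (abc-iut-L4-t17) -/


/-- The 2-cell `φ_{b′}` of a morphism, with the target branch PRESENTED as `b` (`p : φ(b′) = b`):
`φ_{v′}^* ⋙ b′^* ≅ b^* ⋙ φ_{e′}^*` with `φ_{e′}^* : 𝒢_{e(b)} ⥤ 𝒢′_{e′}` (transport of `Hom.φB` along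
`p`). [cite: MochizukiSemiAnbd2006, Rem. 2.4.2 p.26] -/
noncomputable def Hom.φBOver (φ : Hom 𝒢' 𝒢) (b' : 𝒢'.graph.Branch) (v' : 𝒢'.graph.Vertex)
    (h' : 𝒢'.graph.abuts b' = some v') (b : 𝒢.graph.Branch) (p : φ.base.branchMap b' = b) :
    (φ.φV v').pullback ⋙ (𝒢'.pull b' v' h').pullback ≅
      (𝒢.pull b (φ.base.vertexMap v') (p ▸ φ.base.abuts_branchMap b' v' h')).pullback ⋙
        (φ.φE (𝒢'.graph.edgeOf b') (𝒢.graph.edgeOf b)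
          (by rw [← p]; exact (φ.base.edgeOf_branchMap b').symm)).pullback := by
  subst p
  exact φ.φB b' v' h'

/-- The ALIGNED FRAME of `𝒢` at `b` determined by the 2-cell `φ_{b′}` and basepoint data
`(F′, F_e′, α′)` of `𝒢′` at `b′`: `b^* ⋙ (φ_{e′}^* ⋙ F_e′) ≅ φ_{v′}^* ⋙ F′`.
[cite: MochizukiSemiAnbd2006, Rem. 2.4.2 p.26] -/
noncomputable def Hom.alignIso (φ : Hom 𝒢' 𝒢) (b' : 𝒢'.graph.Branch) (v' : 𝒢'.graph.Vertex)
    (h' : 𝒢'.graph.abuts b' = some v') (b : 𝒢.graph.Branch) (p : φ.base.branchMap b' = b)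
    (F' : 𝒢'.V v' ⥤ FintypeCat.{v₁}) (Fe' : 𝒢'.E (𝒢'.graph.edgeOf b') ⥤ FintypeCat.{v₁})
    (α' : (𝒢'.pull b' v' h').pullback ⋙ Fe' ≅ F') :
    (𝒢.pull b (φ.base.vertexMap v') (p ▸ φ.base.abuts_branchMap b' v' h')).pullback ⋙
        ((φ.φE (𝒢'.graph.edgeOf b') (𝒢.graph.edgeOf b)
          (by rw [← p]; exact (φ.base.edgeOf_branchMap b').symm)).pullback ⋙ Fe') ≅
      (φ.φV v').pullback ⋙ F' :=
  (isoWhiskerRight (φ.φBOver b' v' h' b p) Fe').symm ≪≫ isoWhiskerLeft (φ.φV v').pullback α'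

/-- The ALIGNED BRANCH SUBGROUP `Π_b^{al} ⊆ Π_v = Aut (φ_{v′}^* ⋙ F′)`: the branch subgroup of `𝒢` at
`b` for the edge basepoint `φ_{e′}^* ⋙ F_e′` and the aligned frame.  Unconditionally
`ι(Π_{b′}) ≤ Π_b^{al}` with finite index (finite étale `φ_{e′}`). [cite: MochizukiSemiAnbd2006, Rem. 2.4.1 p.26] -/
noncomputable def Hom.alignedBranchSubgroup (φ : Hom 𝒢' 𝒢) (b' : 𝒢'.graph.Branch)
    (v' : 𝒢'.graph.Vertex) (h' : 𝒢'.graph.abuts b' = some v') (b : 𝒢.graph.Branch)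
    (p : φ.base.branchMap b' = b) (F' : 𝒢'.V v' ⥤ FintypeCat.{v₁})
    (Fe' : 𝒢'.E (𝒢'.graph.edgeOf b') ⥤ FintypeCat.{v₁}) (α' : (𝒢'.pull b' v' h').pullback ⋙ Fe' ≅ F') :
    Subgroup (𝒢.PiV (φ.base.vertexMap v') ((φ.φV v').pullback ⋙ F')) :=
  𝒢.branchSubgroup ((φ.φV v').pullback ⋙ F') b (p ▸ φ.base.abuts_branchMap b' v' h') _
    (φ.alignIso b' v' h' b p F' Fe' α')

/-- `φ : 𝒢′ → 𝒢` is **branch-aligned**: for every vertex `v′`, basepoint `F′` of `𝒢′_{v′}` and branch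
`b` of `𝒢` (write `ι := π₁(φ_{v′}^*)_{F′} : Π_{v′} → Π_v`):
(i) for every branch `b′` at `v′` over `b` and all basepoint data, `ι⁻¹(Π_b^{al}) ≤ Π_{b′}` — with the
unconditional `ι(Π_{b′}) ≤ Π_b^{al}` this says `ι(Π_{b′}) = Π_b^{al} ∩ ι(Π_{v′})`;
(ii) for two DISTINCT branches `b′₁ ≠ b′₂` at `v′` over `b`, all basepoint data and every isomorphism
`θ` of the two induced edge basepoints of `𝒢_{e(b)}`, the transport element
`t := α₂⁻¹ ≫ b^*θ ≫ α₁ ∈ Π_v` (which satisfies `Π_{b,1}^{al} = t Π_{b,2}^{al} t⁻¹`) lies OUTSIDE the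
product set `Π_{b,1}^{al} · ι(Π_{v′})`, spelled `t ≠ β · ι(u)` (distinct branches ↦ distinct double
cosets).
Holds for the covering CONSTRUCTED from an object of `B(𝒢)` (p. 23); fails for twisted branch
functors (finding L4t17-F1). [cite: MochizukiSemiAnbd2006, Def. 2.2(i) p.23] -/
def Hom.IsBranchAligned (φ : Hom 𝒢' 𝒢) : Prop :=
  ∀ (v' : 𝒢'.graph.Vertex) (F' : 𝒢'.V v' ⥤ FintypeCat.{v₁}) [PreGaloisCategory.FiberFunctor F']
    (b : 𝒢.graph.Branch),
    (∀ (b' : 𝒢'.graph.Branch) (h' : 𝒢'.graph.abuts b' = some v') (p : φ.base.branchMap b' = b)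
        (Fe' : 𝒢'.E (𝒢'.graph.edgeOf b') ⥤ FintypeCat.{v₁}) [PreGaloisCategory.FiberFunctor Fe']
        (α' : (𝒢'.pull b' v' h').pullback ⋙ Fe' ≅ F'),
        (φ.alignedBranchSubgroup b' v' h' b p F' Fe' α').comap (pi1Map (φ.φV v').pullback F') ≤
          𝒢'.branchSubgroup F' b' h' Fe' α') ∧
    ∀ (b'₁ b'₂ : 𝒢'.graph.Branch) (h₁ : 𝒢'.graph.abuts b'₁ = some v')
        (h₂ : 𝒢'.graph.abuts b'₂ = some v') (p₁ : φ.base.branchMap b'₁ = b)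
        (p₂ : φ.base.branchMap b'₂ = b), b'₁ ≠ b'₂ →
      ∀ (Fe'₁ : 𝒢'.E (𝒢'.graph.edgeOf b'₁) ⥤ FintypeCat.{v₁}) [PreGaloisCategory.FiberFunctor Fe'₁]
        (α'₁ : (𝒢'.pull b'₁ v' h₁).pullback ⋙ Fe'₁ ≅ F')
        (Fe'₂ : 𝒢'.E (𝒢'.graph.edgeOf b'₂) ⥤ FintypeCat.{v₁}) [PreGaloisCategory.FiberFunctor Fe'₂]
        (α'₂ : (𝒢'.pull b'₂ v' h₂).pullback ⋙ Fe'₂ ≅ F')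
        (θ : (φ.φE (𝒢'.graph.edgeOf b'₂) (𝒢.graph.edgeOf b)
              (by rw [← p₂]; exact (φ.base.edgeOf_branchMap b'₂).symm)).pullback ⋙ Fe'₂ ≅
            (φ.φE (𝒢'.graph.edgeOf b'₁) (𝒢.graph.edgeOf b)
              (by rw [← p₁]; exact (φ.base.edgeOf_branchMap b'₁).symm)).pullback ⋙ Fe'₁)
        (β : Aut ((φ.φV v').pullback ⋙ F')) (_ : β ∈ φ.alignedBranchSubgroup b'₁ v' h₁ b p₁ F' Fe'₁ α'₁)
        (u : Aut F'),
        ((φ.alignIso b'₂ v' h₂ b p₂ F' Fe'₂ α'₂).symm ≪≫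
              isoWhiskerLeft
                (𝒢.pull b (φ.base.vertexMap v') (p₂ ▸ φ.base.abuts_branchMap b'₂ v' h₂)).pullback θ ≪≫
              φ.alignIso b'₁ v' h₁ b p₁ F' Fe'₁ α'₁ :
            Aut ((φ.φV v').pullback ⋙ F')) ≠ β * pi1Map (φ.φV v').pullback F' u

end SemiGraphOfAnabelioids

end Literature.AnabelianGeometry.SemiGraphs
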